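import Literature.Computability.AlgebraicComplexity.BaurStrassenTensorRank
import HarnessLib

/-!
# ValiantsHypothesis / RyserTripartition — crux `TripartitionHard` (stmt-ValiantsHypothesis-7160),
# line `Cruxes/TripartitionHard/Lines/birth.lean`, registered stub `stub_rankLeComplexity`

The registered stub `stub_rankLeComplexity` (size M of the birth line, "rank-to-circuit for cubic
forms") is PROVED here, verbatim as registered: there is an absolute constant `c` (namely `c = 6`)
such that for every finite index type `ι` and every tensor `t : ι → ι → ι → ℂ` the tensor rank of `t`
is at most `c` times the fan-in-two circuit complexity of its trilinear form
`F_t = Σ_{i,j,l} t(i,j,l) · X_(0,i) X_(1,j) X_(2,l) ∈ ℂ[Fin 3 × ι]`.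

## Proof (Baur–Strassen 1983 Thm. 1 = BCS 1997 Thm. (7.7), with BCS 1997 Prop. (14.1)/(14.8))

All three engines are tree theorems and are imported BY NAME:
* `exists_isNonscalarSeq_length_le_complexity` — a nonscalar computation sequence of length
  `≤ L(F_t)` whose cost-free span contains `F_t` (BCS (4.7));
* `exists_isNonscalarSeq_forall_pderiv` — Baur–Strassen: one of length `≤ 3 L(F_t)` containing all
  first partials `∂F_t/∂X_v`;
* `exists_triads_of_isNonscalarSeq` — for the family `(∂F_t/∂X_(0,i))_i` and the two disjoint
  variable families `X_(1,·)`, `X_(2,·)`, the 3-tensor of bilinear coefficients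
  `(i, j, l) ↦ coeff_{X_(1,j) X_(2,l)} ∂F_t/∂X_(0,i)` is a sum of `≤ 2 · 3 L(F_t)` triads.
The one new calculation is `coeff_{X_(1,j) X_(2,l)} ∂F_t/∂X_(0,i) = t(i,j,l)`
(`coeff_pderiv_trilinear`), after which `tensorRank_le_of_eq_sum` gives `R(t) ≤ 6 · L(F_t)`.

**v2 (route-independent home).** The general lemma now lives in the LITERATURE file
`Literature/Computability/AlgebraicComplexity/BaurStrassenTensorRank.lean` (over any commutative
ring); every theorem of this file keeps its name and statement and is the one-line specialisation to
`ℂ` (route RyserTripartition is DORMANT since 2026-08-27; this file is the corollary only).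

Honest framing: this closes only the size-M stub of the line; the load-bearing stub `stub_rankHard`
(an explicit super-linear tensor-rank lower bound for Pratt's tripartition tensor, beyond the rank-method
ceiling; conditional on the Set Cover Conjecture via the tree's named fact `pratt2024_cor_1_12`) and the
crux `RyserTripartition.TripartitionHard` remain OPEN; `VP ≠ VNP` is NOT proved and nothing here is
progress on it. No new definitions, no named facts.
-/

noncomputable section

-- `Summit.ValiantsHypothesis.ValiantsHypothesis.…` is the tree's mandated single-conjunct layout
-- (Sub = Summit), so the duplicated namespace component is intended.
set_option linter.dupNamespace false

namespace Summit.ValiantsHypothesis.ValiantsHypothesis.Theorems.RyserTripartitionTripartitionHard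

open Literature.Computability.AlgebraicComplexity MvPolynomial

/-! ### The bilinear coefficients of the partials of a trilinear form -/

/-- The monomial form of one term of the trilinear form. [folklore] -/
theorem term_eq_monomial {ι : Type} (c : ℂ) (i j l : ι) :
    (MvPolynomial.C c * MvPolynomial.X (0, i) * MvPolynomial.X (1, j) * MvPolynomial.X (2, l) :
      MvPolynomial (Fin 3 × ι) ℂ) =
      monomial (Finsupp.single ((0 : Fin 3), i) 1 + Finsupp.single ((1 : Fin 3), j) 1 +
        Finsupp.single ((2 : Fin 3), l) 1) c :=
  Literature.Computability.AlgebraicComplexity.trilinearTerm_eq_monomial c i j l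

/-- The bilinear coefficient `coeff_{X_(1,a) X_(2,b)} ∂/∂X_(0,o)` of one term
`c · X_(0,i) X_(1,j) X_(2,l)` is `c` if `(i,j,l) = (o,a,b)` and `0` otherwise. [folklore] -/
theorem coeff_pderiv_term {ι : Type} [DecidableEq ι] (c : ℂ) (i j l o a b : ι) :
    MvPolynomial.coeff (Finsupp.single ((1 : Fin 3), a) 1 + Finsupp.single ((2 : Fin 3), b) 1)
      (MvPolynomial.pderiv ((0 : Fin 3), o)
        (MvPolynomial.C c * MvPolynomial.X (0, i) * MvPolynomial.X (1, j) * MvPolynomial.X (2, l) :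
          MvPolynomial (Fin 3 × ι) ℂ)) =
      if i = o ∧ j = a ∧ l = b then c else 0 :=
  Literature.Computability.AlgebraicComplexity.coeff_pderiv_trilinearTerm c i j l o a b

/-- **The one new calculation.** For the trilinear form `F_t = Σ t(i,j,l) X_(0,i) X_(1,j) X_(2,l)`:
`coeff_{X_(1,a) X_(2,b)} (∂F_t/∂X_(0,o)) = t(o,a,b)`. [folklore] -/
theorem coeff_pderiv_trilinear {ι : Type} [Fintype ι] (t : ι → ι → ι → ℂ) (o a b : ι) :
    MvPolynomial.coeff (Finsupp.single ((1 : Fin 3), a) 1 + Finsupp.single ((2 : Fin 3), b) 1)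
      (MvPolynomial.pderiv ((0 : Fin 3), o)
        (∑ i : ι, ∑ j : ι, ∑ l : ι,
          (MvPolynomial.C (t i j l) * MvPolynomial.X (0, i) * MvPolynomial.X (1, j) *
            MvPolynomial.X (2, l) : MvPolynomial (Fin 3 × ι) ℂ))) = t o a b :=
  Literature.Computability.AlgebraicComplexity.coeff_pderiv_trilinear t o a b

/-! ### The stub -/

/-- **Explicit form** of the registered stub with the constant `c = 6`: tensor rank is at most six
times the fan-in-two circuit complexity of the trilinear form (Baur–Strassen 1983, Thm. 1 = BCS 1997
Thm. (7.7); BCS 1997 Prop. (14.1)/(14.8) `R ≤ 2 L^{ns}`; BCS (4.7) `L^{ns} ≤ L`).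
[cite: BaurStrassen1983, Thm. 1] [cite: BurgisserClausenShokrollahi1997, Thm. (7.7), Prop. (14.1)] -/
theorem tensorRank_le_six_mul_complexity (ι : Type) [Fintype ι] (t : ι → ι → ι → ℂ) :
    tensorRank t ≤ 6 * complexity (∑ i : ι, ∑ j : ι, ∑ l : ι,
      (MvPolynomial.C (t i j l) * MvPolynomial.X (0, i) * MvPolynomial.X (1, j) *
        MvPolynomial.X (2, l) : MvPolynomial (Fin 3 × ι) ℂ)) :=
  Literature.Computability.AlgebraicComplexity.tensorRank_le_six_mul_complexity ι t

/-- **stub_rankLeComplexity** (registered stub of crux `RyserTripartition.TripartitionHard`,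
stmt-ValiantsHypothesis-7160, line `birth`; signature VERBATIM as registered): rank-to-circuit for
cubic forms — there is an absolute constant `c` such that for every finite type `ι` and every tensor
`t : ι → ι → ι → ℂ`, the tensor rank of `t` is at most `c` times the fan-in-two circuit complexity of
the trilinear form `F_t = Σ_{i,j,l} t(i,j,l) · X_(0,i) X_(1,j) X_(2,l) ∈ ℂ[Fin 3 × ι]`; `c = 6` by
`tensorRank_le_six_mul_complexity`.
[cite: BaurStrassen1983, Thm. 1] [cite: BurgisserClausenShokrollahi1997, Thm. (7.7), Prop. (14.1)] -/
theorem stub_rankLeComplexity :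
    ∃ c : ℕ, ∀ (ι : Type) [Fintype ι] (t : ι → ι → ι → ℂ),
      tensorRank t ≤ c * complexity (∑ i : ι, ∑ j : ι, ∑ l : ι,
        (MvPolynomial.C (t i j l) * MvPolynomial.X (0, i) * MvPolynomial.X (1, j) *
          MvPolynomial.X (2, l) : MvPolynomial (Fin 3 × ι) ℂ)) :=
  ⟨6, fun ι _ t => tensorRank_le_six_mul_complexity ι t⟩

end Summit.ValiantsHypothesis.ValiantsHypothesis.Theorems.RyserTripartitionTripartitionHard

end
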